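import Summits.ResolutionOfSingularities.ResolutionOfSingularities.Theorems.PurelyInseparableDim4WildConesRun
import Mathlib.RingTheory.Artinian.Ring
import Mathlib.RingTheory.Jacobson.Ideal
import Mathlib.FieldTheory.IsAlgClosed.AlgebraicClosure
import HarnessLib
import HarnessLib.Audit.Tags

/-!
# Every prime `p`, EVERY field: no infinite point-blow-up chain of Milnor-finite `p`-fold states
# (bridge WildCones ↔ `PIDim4`, part 4: removing the perfect-field hypothesis of part 3 by base change)

[OURS · counted 0 · bookkeeping; nothing here is a statement about resolution of singularities.]

Part 3's `noMilnorFiniteStep0Chain` inherits `PerfectField K` from the route's target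
`IsolatedForcedTermination`.  The frame quantifies over ALL fields of characteristic `p`; this file
closes the gap by base change to the algebraic closure:

* §1 `exists_maximalIdeal_pow_le_of_finite` — a finite formal Milnor algebra `K⟦x⟧ ⧸ Ĵ` is Artinian
  LOCAL, so `𝔪̂ᴺ ≤ Ĵ` for some `N` (the converse of `Jets.finite_quotient_maximalIdeal_pow`);
* §2 `milnorFinite_map` — Milnor-finiteness goes UP along a field homomorphism `f : K → L`
  (`𝔪̂_Kᴺ ≤ Ĵ_K` maps to `𝔪̂_Lᴺ ≤ Ĵ_L`: the variables generate both maximal ideals, and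
  `∂ᵢ` / coercion commute with `MvPolynomial.map f`);
* §3 **`noMilnorFiniteStep0Chain_all`** — every prime `p`, EVERY field `K` of characteristic `p`:
  no infinite `Step0 p` chain whose states from index `1` are Milnor-finite (part 3 over
  `AlgebraicClosure K`, chains go up by p-14's `IsolationConverse.step0_map`).

bears_on: LADDER-RESOLUTION:D157-DOOR2 (res-dim4-pi · F4-I(p,p) partial, all fields).
Supports stmt-ResolutionOfSingularities-16155 (helper).
-/

set_option linter.dupNamespace false

noncomputable section

namespace Summit.ResolutionOfSingularities.ResolutionOfSingularities.Theorems.PIDim4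

namespace WildConesBridge

open MvPolynomial IsLocalRing
open Literature.AlgebraicGeometry.Resolution

variable {K : Type} [Field K]

/-! ## 1. Finite formal algebra ⇒ a power of `𝔪̂` inside the ideal -/

/-- **A finite-dimensional quotient `K⟦x⟧ ⧸ J` contains a power of the maximal ideal in `J`**: the
quotient is an Artinian local ring, its maximal ideal `= 𝔪̂ · (K⟦x⟧ ⧸ J)` is nilpotent. [folklore] -/
theorem exists_maximalIdeal_pow_le_of_finite {J : Ideal (MvPowerSeries (Fin 4) K)}
    (hfin : Module.Finite K (MvPowerSeries (Fin 4) K ⧸ J)) :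
    ∃ N : ℕ, maximalIdeal (MvPowerSeries (Fin 4) K) ^ N ≤ J := by
  by_cases hJ : J = ⊤
  · exact ⟨1, hJ ▸ le_top⟩
  haveI : IsArtinianRing (MvPowerSeries (Fin 4) K ⧸ J) :=
    IsArtinianRing.of_finite K (MvPowerSeries (Fin 4) K ⧸ J)
  obtain ⟨N, hN⟩ := IsArtinianRing.isNilpotent_jacobson_bot (R := MvPowerSeries (Fin 4) K ⧸ J)
  refine ⟨N, ?_⟩
  have hmap : (maximalIdeal (MvPowerSeries (Fin 4) K)).map (Ideal.Quotient.mk J) =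
      Ideal.jacobson (⊥ : Ideal (MvPowerSeries (Fin 4) K ⧸ J)) := by
    rw [← IsLocalRing.jacobson_eq_maximalIdeal J hJ,
      Ideal.map_jacobson_of_surjective Ideal.Quotient.mk_surjective (by rw [Ideal.mk_ker]),
      Ideal.map_quotient_self]
  have h : ((maximalIdeal (MvPowerSeries (Fin 4) K)) ^ N).map (Ideal.Quotient.mk J) = ⊥ := by
    rw [Ideal.map_pow, hmap, hN, Ideal.zero_eq_bot]
  rw [Ideal.map_eq_bot_iff_le_ker, Ideal.mk_ker] at h
  exact h

/-! ## 2. Milnor-finiteness goes up along field homomorphisms -/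

section Map

variable {L : Type} [Field L] (f : K →+* L)

/-- Coercion to power series commutes with the coefficient map. [folklore] -/
theorem coe_map_eq (F : MvPolynomial (Fin 4) K) :
    ((MvPolynomial.map f F : MvPolynomial (Fin 4) L) : MvPowerSeries (Fin 4) L) =
      MvPowerSeries.map f (F : MvPowerSeries (Fin 4) K) := by
  ext e
  rw [MvPolynomial.coeff_coe, MvPolynomial.coeff_map, MvPowerSeries.coeff_map, MvPolynomial.coeff_coe]

/-- `∂ᵢ` commutes with the coefficient map on power series. [folklore] -/
theorem map_pderiv (t : Fin 4) (g : MvPowerSeries (Fin 4) K) :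
    MvPowerSeries.map f (MvPowerSeries.pderiv t g) = MvPowerSeries.pderiv t (MvPowerSeries.map f g) := by
  ext e
  rw [MvPowerSeries.coeff_map, MvPowerSeries.coeff_pderiv, MvPowerSeries.coeff_pderiv,
    MvPowerSeries.coeff_map, map_mul, map_add, map_natCast, map_one]

/-- The maximal ideal of `K⟦x⟧` maps ONTO generators of the maximal ideal of `L⟦x⟧`. [folklore] -/
theorem map_maximalIdeal_eq :
    (maximalIdeal (MvPowerSeries (Fin 4) K)).map (MvPowerSeries.map f) =
      maximalIdeal (MvPowerSeries (Fin 4) L) := by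
  have hfun : (fun i : Fin 4 => (MvPowerSeries.X i : MvPowerSeries (Fin 4) L)) =
      (MvPowerSeries.map f) ∘ fun i : Fin 4 => (MvPowerSeries.X i : MvPowerSeries (Fin 4) K) := by
    funext i
    rw [Function.comp_apply, MvPowerSeries.map_X]
  rw [maximalIdeal_eq_span_X, maximalIdeal_eq_span_X, Ideal.map_span, ← Set.range_comp, hfun]

/-- The formal Jacobian ideal maps to the formal Jacobian ideal of the mapped polynomial. [folklore] -/
theorem map_span_pderiv_coe (F : MvPolynomial (Fin 4) K) :
    (Ideal.span (Set.range fun t : Fin 4 =>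
        MvPowerSeries.pderiv t ((F : MvPolynomial (Fin 4) K) : MvPowerSeries (Fin 4) K))).map
        (MvPowerSeries.map f) =
      Ideal.span (Set.range fun t : Fin 4 => MvPowerSeries.pderiv t
        (((MvPolynomial.map f F : MvPolynomial (Fin 4) L)) : MvPowerSeries (Fin 4) L)) := by
  have hfun : (fun t : Fin 4 => MvPowerSeries.pderiv t
        (((MvPolynomial.map f F : MvPolynomial (Fin 4) L)) : MvPowerSeries (Fin 4) L)) =
      (MvPowerSeries.map f) ∘ fun t : Fin 4 =>
        MvPowerSeries.pderiv t ((F : MvPolynomial (Fin 4) K) : MvPowerSeries (Fin 4) K) := by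
    funext t
    rw [Function.comp_apply, map_pderiv, coe_map_eq]
  rw [Ideal.map_span, ← Set.range_comp, hfun]

/-- **Milnor-finiteness goes UP** along a field homomorphism. [folklore] -/
theorem milnorFinite_map {F : MvPolynomial (Fin 4) K}
    (hfin : Module.Finite K (MvPowerSeries (Fin 4) K ⧸ Ideal.span (Set.range fun t : Fin 4 =>
      MvPowerSeries.pderiv t ((F : MvPolynomial (Fin 4) K) : MvPowerSeries (Fin 4) K)))) :
    Module.Finite L (MvPowerSeries (Fin 4) L ⧸ Ideal.span (Set.range fun t : Fin 4 =>
      MvPowerSeries.pderiv t (((MvPolynomial.map f F : MvPolynomial (Fin 4) L)) :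
        MvPowerSeries (Fin 4) L))) := by
  obtain ⟨N, hN⟩ := exists_maximalIdeal_pow_le_of_finite hfin
  have h := Ideal.map_mono (f := MvPowerSeries.map f) hN
  rw [Ideal.map_pow, map_maximalIdeal_eq, map_span_pderiv_coe] at h
  haveI := Literature.RingTheory.MvPowerSeries.Jets.finite_quotient_maximalIdeal_pow
    (σ := Fin 4) (K := L) N
  exact Module.Finite.of_surjective (Ideal.Quotient.factorₐ L h).toLinearMap
    (Ideal.Quotient.factor_surjective h)

end Map

/-! ## 3. Every prime, every field -/

/-- **For every prime `p` and EVERY field `K` of characteristic `p`: there is no infinite `Step0 p`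
chain of the frame whose states from index `1` have finite formal Milnor algebra** (part 3 over the
algebraic closure of `K`; the chain goes up by p-14's `IsolationConverse.step0_map`, Milnor-finiteness
by §2).  The PARTIAL F4-I(p,p) for `p ≥ 3` without the perfect-field restriction. [OURS · counted 0]
[cite: HauserPerlega2019, §1 p. 3 (the forced-cycle question)] -/
theorem noMilnorFiniteStep0Chain_all (p : ℕ) (hp : p.Prime) (K : Type) [Field K] [CharP K p]
    [DecidableEq K] :
    ¬ ∃ c : ℕ → State K, ∀ k, Step0 p (c k) (c (k + 1)) ∧
      Module.Finite K (MvPowerSeries (Fin 4) K ⧸ Ideal.span (Set.range fun t : Fin 4 =>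
        MvPowerSeries.pderiv t (((c (k + 1)).F : MvPolynomial (Fin 4) K) : MvPowerSeries (Fin 4) K))) := by
  classical
  rintro ⟨c, hc⟩
  let L : Type := AlgebraicClosure K
  let f : K →+* L := algebraMap K L
  refine noMilnorFiniteStep0Chain p hp L
    ⟨fun k => ⟨MvPolynomial.map f (c k).F, (c k).r, (c k).exc⟩, fun k => ⟨?_, ?_⟩⟩
  · exact IsolationConverse.step0_map f (hc k).1
  · exact milnorFinite_map f (hc k).2

/-! ## 4. Shift closure over every field (appended 2026-08-28T18:1xZ for p-5's F4-I(3,3) reduction) -/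

/-- **Every infinite `Step0 p` chain over EVERY field of characteristic `p` has Milnor-INFINITE states
beyond every index** (the all-fields form of `infinitely_many_not_milnorFinite`): the reduction
«F4-I(p,p) ⟸ no isolated chain with a cofinal Milnor-infinite subsequence» is immediate from it.
[OURS · counted 0] [folklore] -/
theorem infinitely_many_not_milnorFinite_all (p : ℕ) (hp : p.Prime) (K : Type) [Field K] [CharP K p]
    [DecidableEq K] (c : ℕ → State K) (hc : ∀ k, Step0 p (c k) (c (k + 1))) (N : ℕ) :
    ∃ k, N ≤ k ∧ ¬ Module.Finite K (MvPowerSeries (Fin 4) K ⧸ Ideal.span (Set.range fun t : Fin 4 =>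
      MvPowerSeries.pderiv t (((c k).F : MvPolynomial (Fin 4) K) : MvPowerSeries (Fin 4) K))) := by
  by_contra h
  push Not at h
  refine noMilnorFiniteStep0Chain_all p hp K ⟨fun k => c (N + k), fun k => ⟨?_, ?_⟩⟩
  · show Step0 p (c (N + k)) (c (N + (k + 1)))
    exact hc (N + k)
  · show Module.Finite K (MvPowerSeries (Fin 4) K ⧸ Ideal.span (Set.range fun t : Fin 4 =>
      MvPowerSeries.pderiv t (((c (N + (k + 1))).F : MvPolynomial (Fin 4) K) : MvPowerSeries (Fin 4) K)))
    exact h (N + (k + 1)) (Nat.le_add_right N (k + 1))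

/-- **F4-I(p,p) reduced, every prime, every field**: `NoIsolatedTrap p p` holds iff no `Step0 p` chain
has all states `J_p⁺`-ISOLATED and a COFINAL set of Milnor-INFINITE states — the Milnor-finite tails are
excluded by the route `WildCones`; what is left open (p ≥ 3) is exactly the alternation with
`J_p⁺`-isolated, gradient-non-primary states. [OURS · counted 0] [folklore] -/
theorem noIsolatedTrap_iff_no_cofinal_milnorInfinite (p : ℕ) (hp : p.Prime) :
    NoIsolatedTrap p p ↔ ∀ (K : Type) [Field K] [CharP K p] [DecidableEq K],
      ¬ ∃ c : ℕ → State K, (∀ k, IsIsolated p (c k).F ∧ Step0 p (c k) (c (k + 1))) ∧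
        ∀ N, ∃ k, N ≤ k ∧ ¬ Module.Finite K (MvPowerSeries (Fin 4) K ⧸ Ideal.span (Set.range
          fun t : Fin 4 => MvPowerSeries.pderiv t
            (((c k).F : MvPolynomial (Fin 4) K) : MvPowerSeries (Fin 4) K))) := by
  constructor
  · intro h K _ _ _
    rintro ⟨c, hc, -⟩
    exact h K ⟨c, hc⟩
  · intro h K _ _ _
    rintro ⟨c, hc⟩
    exact h K ⟨c, hc, infinitely_many_not_milnorFinite_all p hp K c (fun k => (hc k).2)⟩

end WildConesBridge

end Summit.ResolutionOfSingularities.ResolutionOfSingularities.Theorems.PIDim4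

end
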